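import Literature.AlgebraicGeometry.Frobenioids.Thm36SubModel
import HarnessLib

/-!
# Frobenioids II, Theorem 3.6 (i) for `C^ℝ`: "`(C^Λ)^un-tr ⥲ C^ℝ`" at `Λ ∈ {ℤ, ℝ}` and the characteristic splitting
# on `C^ℝ` — PROVED (closes the slots `untrEquiv_Z`, `untrEquiv_R`, `charSplitting_R` of `Thm36SubModel.lean`)

Mochizuki, *The geometry of Frobenioids II: poly-Frobenioids*, Kyushu J. Math. **62** (2008) 401–460, §3,
Theorem 3.6 (i), kurims text p. 36: "the canonical decomposition of Definition 3.1, (ii), determines a characteristic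
splitting [cf. [Mzk5], Definition 2.3] on `C^Λ` … For arbitrary `Λ`, there is a natural equivalence of categories
`(C^Λ)^un-tr ⥲ C^ℝ`, compatible with the Frobenioid structures" [cite: MochizukiFrdII2008, Thm 3.6 (i) p.36].

PROOF-ONLY companion (abc-iut cell, L1 row M13-c; seat abc-iut-w4-d074) of `Thm36SubModel.lean`:
* `untrEquiv_Z_holds` — at `Λ = ℤ`: `ι : Φ → Φ^rlf` is bijective for the archimedean Frobenioid
  (`bijective_toRlf_app`), `Φ^birat = Φ^gp` (`biratSubfunctor_carrier_eq_top`) and `ℝ · Φ^birat = (Φ^rlf)^gp`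
  (`realSpan_carrier_eq_top`), so [FrdI] Prop. 5.3's `C^un-tr → C^rlf` — the functor of model Frobenioids induced by
  the morphism of model data `(Φ, Φ^birat, incl) → (Φ^rlf, ℝ · Φ^birat, incl)`, `η = ι`, `β = ι^gp` — is an
  EQUIVALENCE (abc-iut-w5-d137's `ModelFrobenioid.DataHomOver.functor_isEquivalence`, [FrdI] Cor. 5.4), and it is
  compatible with the structure functors read in `F_{Φ^rlf}` along `ι` (`ElemFrobenioid.mapNatTrans ι`);
* `untrEquiv_R_holds` — at `Λ = ℝ`: the rational-function monoid `(Φ^rlf)^birat` of the model Frobenioid `C^rlf` is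
  ALL of `(Φ^rlf)^gp` (`biratSubfunctor_rlfStr_carrier_eq_top`: at the object `(X, 0)` the pair `(𝟙, (1, id, z, [z]))`
  is a (co-angular, [FrdI] Thm. 5.2 (ii) `ModelFrobenioid.isCoAngular`) pre-step pair with germ `[z]⁻¹`), so the
  morphism of model data `((Φ^rlf)^birat ↪ ℝ · Φ^birat)` over the identity induces an equivalence
  `(C^rlf)^un-tr ⥲ C^rlf` compatible with the structure functors;
* `charSplitting_R_holds` — `τ(A) := O^▷(A)` is a characteristic splitting on `C^rlf` ([FrdI] Def. 2.3): (a) because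
  `O^×(A) = {1}` (`rlf_unitsSubgroup_eq_bot`, Thm. 3.6 (v) (c)), (b) because an isotropic hull of an (isotropic) object
  of `C^rlf` is an isomorphism.
Nothing is (re)defined; no side is taken on [IUTchIII] Cor. 3.12.
-/

noncomputable section

namespace Literature.AlgebraicGeometry.Frobenioids

open CategoryTheory Opposite Function Literature.AnabelianGeometry.EtaleTheta
open scoped NNReal

universe v u

namespace ArchFrd

namespace Thm36Sub

variable {D : Type u} [Category.{v} D] (π : D ⥤ D0)

/-! ### `(C^ℤ)^un-tr ⥲ C^ℝ` -/

/-- **Thm. 3.6 (i), "`(C^Λ)^un-tr ⥲ C^ℝ` compatible with the Frobenioid structures", `Λ = ℤ`** — closes the slot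
`Thm36Sub.untrEquiv_Z`. [cite: MochizukiFrdII2008, Thm 3.6 (i) p.36] -/
theorem untrEquiv_Z_holds : Literature.AlgebraicGeometry.Frobenioids.ArchFrd.Thm36Sub.untrEquiv_Z π := by
  let R := RealificationData.canonical (Φ π) (PreFrobenioid.IsPerfFactorialOn.op (isPerfFactorialOn_Φ π))
  let Ψ := PreFrobenioid.biratSubfunctor (C.toElem π)
  have hmem : ∀ (X : D) (c : Algebra.GrothendieckGroup (R.rlf.obj (op X))), c ∈ (R.realSpan Ψ).carrier X :=
    fun X c => by rw [realSpan_carrier_eq_top]; exact Subgroup.mem_top _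
  have hmemΨ : ∀ (X : D) (c : Algebra.GrothendieckGroup ((Φ π).obj (op X))), c ∈ Ψ.carrier X :=
    fun X c => by rw [biratSubfunctor_carrier_eq_top]; exact Subgroup.mem_top _
  -- the morphism of model data `(Φ, Φ^birat, incl) → (Φ^rlf, ℝ·Φ^birat, incl)` over the identity of `D`
  let h : ModelFrobenioid.DataHomOver (𝟭 D) Ψ.incl (R.realSpan Ψ).incl :=
    { η := { app := fun X => R.toRlf.app X
             naturality := fun X Y f => R.toRlf.naturality f }
      β := { app := fun X => CommMonCat.ofHom
               (((R.toRlfGp (unop X)).comp (Ψ.carrier (unop X)).subtype).codRestrict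
                 ((R.realSpan Ψ).carrier (unop X)) fun c => hmem (unop X) _)
             naturality := fun X Y f => by
               apply CommMonCat.hom_ext
               apply MonoidHom.ext
               intro c
               apply Subtype.ext
               exact R.toRlfGp_pullGp f.unop c.1 }
      comm := fun A u => rfl }
  have hη : ∀ X : D, Bijective (h.η.app (op X)).hom := fun X => bijective_toRlf_app π (op X)
  have hβ : ∀ X : D, Bijective (h.β.app (op X)).hom := fun X => by
    refine ⟨fun a b hab => Subtype.ext ((bijective_toRlfGp π X).1 (congrArg Subtype.val hab)), fun y => ?_⟩
    obtain ⟨x, hx⟩ := (bijective_toRlfGp π X).2 y.1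
    exact ⟨⟨x, hmemΨ X x⟩, Subtype.ext hx⟩
  haveI hequiv : h.functor.IsEquivalence := h.functor_isEquivalence hη hβ
  let compIso : h.functor ⋙ rlfStr π ≅
      ModelFrobenioid.toElem (Φ π) Ψ.toMonoid Ψ.incl ⋙ ElemFrobenioid.mapNatTrans R.toRlf :=
    NatIso.ofComponents (fun X => Iso.refl _) (fun {X Y} φ =>
      (Category.comp_id _).trans ((ElemFrobenioid.Hom.ext rfl rfl rfl).trans (Category.id_comp _).symm))
  exact ⟨h.functor.asEquivalence, ⟨compIso⟩⟩

/-! ### `(C^ℝ)^un-tr ⥲ C^ℝ` -/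

/-- **`(Φ^rlf)^birat = (Φ^rlf)^gp`** for THE realification `C^rlf` of the archimedean Frobenioid: at the object `(X, 0)`
the identity (a co-angular pre-step, [FrdI] Thm. 5.2 (ii)) and the pre-step `(1, id, z, [z])` are base-equivalent with
birational germ `[z]⁻¹`, so every `[z]`, hence all of `(Φ^rlf)^gp(X)`, lies in `(Φ^rlf)^birat(X)`.
[cite: MochizukiFrdI2008, Prop. 4.4 (iii) p.83] -/
theorem biratSubfunctor_rlfStr_carrier_eq_top (X : D) :
    (PreFrobenioid.biratSubfunctor (rlfStr π)).carrier X = ⊤ := by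
  let R := RealificationData.canonical (Φ π) (PreFrobenioid.IsPerfFactorialOn.op (isPerfFactorialOn_Φ π))
  let Ψ := PreFrobenioid.biratSubfunctor (C.toElem π)
  have hmem : ∀ (c : Algebra.GrothendieckGroup (R.rlf.obj (op X))), c ∈ (R.realSpan Ψ).carrier X :=
    fun c => by rw [realSpan_carrier_eq_top]; exact Subgroup.mem_top _
  have hBg := rlf_objectwise_isGroupLike π
  let A : rlfCat π := ⟨X, 1⟩
  have hof : ∀ z : R.rlf.obj (op X),
      Algebra.GrothendieckGroup.of z ∈ (PreFrobenioid.biratSubfunctor (rlfStr π)).carrier X := by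
    intro z
    let δ₂ : A ⟶ A := ModelFrobenioid.mkHom A A 1 (𝟙 X) z ⟨Algebra.GrothendieckGroup.of z, hmem _⟩ (by
      rw [PNat.one_coe, pow_one, pullGp_id]
      rfl)
    have h₁ : PreFrobenioid.IsCoAngularPreStep (rlfStr π) (𝟙 A) :=
      ⟨ModelFrobenioid.isCoAngular hBg _, ModelFrobenioid.isPreStep_id A⟩
    have h₂ : PreFrobenioid.IsPreStep (rlfStr π) δ₂ := ⟨rfl, show IsIso (𝟙 X) from inferInstance⟩
    have hb : PreFrobenioid.BaseEquivalent (rlfStr π) (𝟙 A) δ₂ := by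
      unfold PreFrobenioid.BaseEquivalent
      rw [PreFrobenioid.base_id]
      rfl
    have hm := PreFrobenioid.div_invDiv_mem_biratSubfunctor (F := rlfStr π) _ _ h₁ h₂ hb
    have e₁ : PreFrobenioid.invDiv (rlfStr π) (𝟙 A) h₁.2.2 = 1 := by
      unfold PreFrobenioid.invDiv
      rw [PreFrobenioid.div_id, map_one]
    have e₂ : PreFrobenioid.invDiv (rlfStr π) δ₂ h₂.2 = z := by
      haveI : IsIso (PreFrobenioid.Base (rlfStr π) δ₂) := h₂.2
      have hinv : inv (PreFrobenioid.Base (rlfStr π) δ₂) = 𝟙 X :=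
        IsIso.inv_eq_of_hom_inv_id (by exact Category.comp_id _)
      unfold PreFrobenioid.invDiv
      rw [hinv]
      erw [pull_id]
      rfl
    rw [e₁, e₂, map_one, one_div] at hm
    exact (Subgroup.inv_mem_iff _).mp hm
  refine eq_top_iff.mpr fun γ _ => ?_
  obtain ⟨a, b, hab⟩ := grothendieckGroup_exists_mul_of_eq_of γ
  rw [eq_div_of_mul_eq' hab]
  exact div_mem (hof a) (hof b)

/-- **Thm. 3.6 (i), "`(C^Λ)^un-tr ⥲ C^ℝ` compatible with the Frobenioid structures", `Λ = ℝ`** — closes the slot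
`Thm36Sub.untrEquiv_R`: the unit-trivialisation of `C^rlf` in its model description is equivalent over `F_{Φ^rlf}`
to `C^rlf`. [cite: MochizukiFrdII2008, Thm 3.6 (i) p.36] -/
theorem untrEquiv_R_holds : Literature.AlgebraicGeometry.Frobenioids.ArchFrd.Thm36Sub.untrEquiv_R π := by
  let R := RealificationData.canonical (Φ π) (PreFrobenioid.IsPerfFactorialOn.op (isPerfFactorialOn_Φ π))
  let Ψ := PreFrobenioid.biratSubfunctor (C.toElem π)
  let Ψ' := PreFrobenioid.biratSubfunctor (rlfStr π)
  have hmem : ∀ (X : D) (c : Algebra.GrothendieckGroup (R.rlf.obj (op X))), c ∈ (R.realSpan Ψ).carrier X :=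
    fun X c => by rw [realSpan_carrier_eq_top]; exact Subgroup.mem_top _
  have hmem' : ∀ (X : D) (c : Algebra.GrothendieckGroup (R.rlf.obj (op X))), c ∈ Ψ'.carrier X :=
    fun X c => by rw [biratSubfunctor_rlfStr_carrier_eq_top]; exact Subgroup.mem_top _
  let h : ModelFrobenioid.DataHomOver (𝟭 D) Ψ'.incl (R.realSpan Ψ).incl :=
    { η := { app := fun X => 𝟙 (R.rlf.obj X)
             naturality := fun X Y f => (Category.comp_id _).trans (Category.id_comp _).symm }
      β := { app := fun X => CommMonCat.ofHom
               ((Ψ'.carrier (unop X)).subtype.codRestrict ((R.realSpan Ψ).carrier (unop X)) fun c => hmem (unop X) _)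
             naturality := fun X Y f => by
               apply CommMonCat.hom_ext
               apply MonoidHom.ext
               intro c
               exact Subtype.ext rfl }
      comm := fun A u => by
        change MonGp.map (MonoidHom.id _) u.1 = u.1
        rw [MonGp.map_id]
        rfl }
  have hη : ∀ X : D, Bijective (h.η.app (op X)).hom := fun X => bijective_id
  have hβ : ∀ X : D, Bijective (h.β.app (op X)).hom := fun X =>
    ⟨fun a b hab => Subtype.ext (by have e := congrArg Subtype.val hab; exact e),
      fun y => ⟨⟨y.1, hmem' X y.1⟩, Subtype.ext rfl⟩⟩
  haveI hequiv : h.functor.IsEquivalence := h.functor_isEquivalence hη hβ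
  let compIso : h.functor ⋙ rlfStr π ≅
      ModelFrobenioid.toElem (rlfFunctor (Φ π) (PreFrobenioid.IsPerfFactorialOn.op (isPerfFactorialOn_Φ π)))
        Ψ'.toMonoid Ψ'.incl :=
    NatIso.ofComponents (fun X => Iso.refl _) (fun {X Y} φ =>
      (Category.comp_id _).trans ((ElemFrobenioid.Hom.ext rfl rfl rfl).trans (Category.id_comp _).symm))
  exact ⟨h.functor.asEquivalence, ⟨compIso⟩⟩

/-! ### The characteristic splitting on `C^ℝ` -/

/-- In `C^rlf` an isotropic hull `φ : A → B` is an isomorphism: `A` is isotropic, so the universal property of `φ`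
produces `β₀ : B → A` with `φ ≫ β₀ = 𝟙` and (by uniqueness) `β₀ ≫ φ = 𝟙`. [cite: MochizukiFrdI2008, Def. 1.2 (iv) p.23] -/
theorem exists_inverse_of_isIsotropicHull_rlf {A B : rlfCat π} (φ : A ⟶ B)
    (hφ : PreFrobenioid.IsIsotropicHull (rlfStr π) φ) :
    ∃ β₀ : B ⟶ A, φ ≫ β₀ = 𝟙 A ∧ β₀ ≫ φ = 𝟙 B := by
  have hA : PreFrobenioid.IsIsotropic (rlfStr π) A := istrAll_R_holds π (fun h => by cases h) A
  obtain ⟨β₀, hβ₀, -⟩ := hφ.2.2.2 (𝟙 A) hA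
  refine ⟨β₀, hβ₀, ?_⟩
  obtain ⟨γ, -, huniq⟩ := hφ.2.2.2 φ hφ.2.2.1
  have h1 : (𝟙 B) = γ := huniq (𝟙 B) (Category.comp_id φ)
  have h2 : β₀ ≫ φ = γ :=
    huniq (β₀ ≫ φ) (show φ ≫ β₀ ≫ φ = φ by rw [← Category.assoc, hβ₀, Category.id_comp])
  rw [h2, ← h1]

/-- **Thm. 3.6 (i), the characteristic splitting on `C^ℝ = C^rlf`** — closes the slot `Thm36Sub.charSplitting_R`:
`τ(A) := O^▷(A)` satisfies [FrdI] Def. 2.3 because `O^×(A)` is trivial and isotropic hulls are isomorphisms.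
[cite: MochizukiFrdII2008, Thm 3.6 (i) p.36] -/
theorem charSplitting_R_holds : Literature.AlgebraicGeometry.Frobenioids.ArchFrd.Thm36Sub.charSplitting_R π := by
  refine ⟨{ τ := fun A => PreFrobenioid.endSubmonoid (rlfStr π) A
            τ_le := fun _ => le_refl _
            res_mem := fun _ _ _ _ _ _ α hα _ => hα
            bijective := fun {A} hA => ?_
            hull := fun {A B} φ hφ β hβ => ?_ }, fun A _ t => Iff.rfl⟩
  · constructor
    · rintro ⟨a, ha⟩ ⟨b, hb⟩ hab
      apply Subtype.ext
      obtain ⟨w, hw⟩ := Associates.mk_eq_mk_iff_associated.mp hab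
      obtain ⟨α, hα, hαw⟩ :=
        (PreFrobenioid.isUnit_endSubmonoid_iff (rlfStr π) (w : PreFrobenioid.endSubmonoid (rlfStr π) A)).mp
          w.isUnit
      have hα1 : α = Iso.refl A := by
        have : α ∈ (⊥ : Subgroup (Aut A)) := by rw [← rlf_unitsSubgroup_eq_bot π A]; exact hα
        exact this
      have hw1 : (w : PreFrobenioid.endSubmonoid (rlfStr π) A).1 = 1 := by
        rw [hα1] at hαw
        exact hαw.symm
      have hval : a * (w : PreFrobenioid.endSubmonoid (rlfStr π) A).1 = b := congrArg Subtype.val hw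
      rw [hw1, mul_one] at hval
      exact hval
    · intro q
      obtain ⟨e, rfl⟩ := Associates.mk_surjective q
      exact ⟨⟨e.1, e.2⟩, rfl⟩
  · obtain ⟨β₀, h1, h2⟩ := exists_inverse_of_isIsotropicHull_rlf π φ hφ
    refine ⟨φ ≫ β ≫ β₀, ⟨?_, ?_⟩, ?_⟩
    · -- base-identity
      change PreFrobenioid.Base (rlfStr π) (φ ≫ β ≫ β₀) = 𝟙 _
      rw [PreFrobenioid.base_comp, PreFrobenioid.base_comp, hβ.1, Category.id_comp, ← PreFrobenioid.base_comp, h1,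
        PreFrobenioid.base_id]
    · -- linear
      change PreFrobenioid.degFr (rlfStr π) (φ ≫ β ≫ β₀) = 1
      have hd : PreFrobenioid.degFr (rlfStr π) (φ ≫ β₀) = 1 := by rw [h1, PreFrobenioid.degFr_id]
      rw [PreFrobenioid.degFr_comp, PreFrobenioid.degFr_comp, hβ.2, one_mul, ← PreFrobenioid.degFr_comp, hd]
    · change φ ≫ β = (φ ≫ β ≫ β₀) ≫ φ
      rw [Category.assoc, Category.assoc, h2, Category.comp_id]

end Thm36Sub

end ArchFrd

end Literature.AlgebraicGeometry.Frobenioids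

end
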